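import Literature.Geometry.Riemannian.ConeRadialIsometry
import Literature.Geometry.Riemannian.TransverseJacobiDerivative
import HarnessLib

/-!
# The exit derivative of the cone map: `½ f'(1) = α² + g(D_s ν, dι β)`

Topic `Geometry/Riemannian`. The sequel of `ConeRadialIsometry.lean` (Gauss identities of the
cone map `C(v) = exp_{ι v}((‖v‖ - 1) ν v)` over a positively `0`-homogeneous presentation
`v ↦ (ι v, ν v)` of a hypersurface with unit normal field `ν`) and of
`TransverseJacobiDerivative.lean` (the initial derivative of the energy of a transverse Jacobi
field). For a unit vector `u`, a smooth curve `γ` in the unit sphere of `V` with `γ 0 = u`,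
`γ'(0) = β ⊥ u`, and `α : ℝ`, the scalar function of the exit criterion of
`WeinsteinCriterion.lean` (hypothesis `hexit` of `two_le_minimalGeodesicMultiplicity_of_radial`),

  `f(t) = g(dC_{t u}(t (α u + β)), dC_{t u}(t (α u + β)))`,

satisfies, for `t > 0` near `1` (`val_mfderiv_coneMap_smul`),

  `f(t) = α² t² + g(J(t - 1), J(t - 1))`,

`J` the transverse Jacobi field of the variation `x(t, s) = exp_{ι γ s}(t ν γ s)` through the
normal geodesics (`C(t γ s) = x(t - 1, s)` by homogeneity, the chain rule, and the two Gauss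
identities `g(dC_v v, dC_v v) = ‖v‖²`, `g(dC_v v, dC_v β) = 0`). Hence
(`hasDerivAt_val_mfderiv_coneMap_smul`, `val_mfderiv_coneMap_one`)

  `f(1) = α² + g(dι_u β, dι_u β)`,  `½ f'(1) = α² + g(D_s(ν ∘ γ)(0), dι_u β)`,

and a lower bound `g(D_s(ν ∘ γ)(0), (ι ∘ γ)'(0)) ≥ -λ g((ι ∘ γ)'(0), (ι ∘ γ)'(0))` along the smooth
curves of the unit sphere — the second fundamental form of the hypersurface w.r.t. `ν` bounded
below by `-λ`, in curve form — gives the exit inequality `-λ f(1) ≤ ½ f'(1)` (`λ ≥ 0`) of the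
criterion (`neg_mul_val_le_half_deriv_coneMap`). This is how the bound `II > -λ` on Weinstein's
sphere `∂D` enters step (4) of the proof of the main theorem of Weinstein 1968.

## References

* A. Weinstein, *The cut locus and conjugate locus of a Riemannian manifold*, Ann. of Math. (2)
  87 (1968), 29–41, proof of the main theorem, steps (3)–(4). [cite: Weinstein1968]
* J. M. Lee, *Introduction to Riemannian Manifolds*, 2nd ed., Springer GTM 176 (2018), Thm. 6.38,
  Problem 10-14. [cite: LeeRiemannianManifolds2018, Problem 10-14]

Tags: [ConeMap] [TransverseJacobiField] [SecondFundamentalForm] [Weinstein1968]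
-/

open Bundle Set Filter Function
open scoped Manifold ContDiff Topology RealInnerProductSpace

namespace Literature.Geometry.Riemannian

open Literature.Geometry.Lorentzian
open Literature.Geometry.Lorentzian.PseudoRiemannianMetric

variable {V : Type*} [NormedAddCommGroup V] [InnerProductSpace ℝ V]
  {E : Type*} [NormedAddCommGroup E] [NormedSpace ℝ E] {H : Type*} [TopologicalSpace H]
  {I : ModelWithCorners ℝ E H} {M : Type*} [TopologicalSpace M] [ChartedSpace H M]
  [IsManifold I ∞ M] {n : ℕ∞ω} [Fact (1 ≤ n)] [FiniteDimensional ℝ E] [CompleteSpace E]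
  [T2Space M] [BoundarylessManifold I M]
  (g : PseudoRiemannianMetric I n E (TangentSpace I : M → Type _)) [g.HasLeviCivita]
  [CovariantDerivative.ContMDiffCovariantDerivative g.leviCivita 1]
  [CovariantDerivative.ContMDiffCovariantDerivative g.leviCivita ((⊤ : ℕ∞) : ℕ∞ω)]
  {ι : V → M} {ν : Π v : V, TangentSpace I (ι v)}

omit [InnerProductSpace ℝ V] [Fact (1 ≤ n)] [FiniteDimensional ℝ E] [CompleteSpace E] [T2Space M]
  [BoundarylessManifold I M] [g.HasLeviCivita]
  [CovariantDerivative.ContMDiffCovariantDerivative g.leviCivita 1]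
  [CovariantDerivative.ContMDiffCovariantDerivative g.leviCivita ((⊤ : ℕ∞) : ℕ∞ω)] in
/-- Transport of a value of `g` along an equality of base points (vectors read in `E`). [folklore] -/
private theorem val_congr_basePoint {x y : M} (h : x = y) (a b : E) :
    g.val x a b = g.val y a b := by
  subst h
  rfl

/-! ### The cone map over the unit sphere is the variation through the normal geodesics -/

omit [Fact (1 ≤ n)] [CompleteSpace E] [T2Space M] [BoundarylessManifold I M]
  [CovariantDerivative.ContMDiffCovariantDerivative g.leviCivita 1]
  [CovariantDerivative.ContMDiffCovariantDerivative g.leviCivita ((⊤ : ℕ∞) : ℕ∞ω)] in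
/-- **`C(t u) = exp_{ι u}((t - 1) ν u)` for `‖u‖ = 1`, `t > 0`**: positive `0`-homogeneity of the
presentation (`(ι (t u), ν (t u)) = (ι u, ν u)` in `TM`) and `‖t u‖ = t`. [folklore] -/
theorem coneMap_smul_of_norm_eq_one
    (hhom : ∀ v : V, v ≠ 0 → ∀ t : ℝ, 0 < t →
      (TotalSpace.mk' E (ι (t • v)) (ν (t • v)) : TangentBundle I M) = TotalSpace.mk' E (ι v) (ν v))
    {u : V} (hu : ‖u‖ = 1) {t : ℝ} (ht : 0 < t) :
    expMap g.leviCivita (ι (t • u)) ((‖t • u‖ - 1) • ν (t • u)) =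
      expMap g.leviCivita (ι u) ((t - 1) • ν u) := by
  have hu0 : u ≠ 0 := by
    rw [← norm_ne_zero_iff, hu]
    exact one_ne_zero
  have hn : ‖t • u‖ = t := by
    rw [norm_smul, Real.norm_eq_abs, abs_of_pos ht, hu, mul_one]
  rw [hn]
  exact expMap_smul_congr_totalSpace g.leviCivita (hhom u hu0 t ht) (t - 1)

/-! ### `f(t) = α² t² + g(J(t - 1), J(t - 1))` -/

/-- **The exit function of the cone map through a transverse Jacobi field.** Let
`v ↦ (ι v, ν v) ∈ TM` be `C^∞` and positively `0`-homogeneous on `V ∖ {0}`, with `|ν|_g = 1`,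
`ν v ⊥ range dι_v`, and the normal geodesics defined for all times in `(-ε, ε)`. Let `γ` be a
smooth curve in the unit sphere of `V` with `γ'(0) = β ⊥ γ 0`, and `α : ℝ`. Then for `t > 0`
with `|t - 1| < ε`, writing `C(v) = exp_{ι v}((‖v‖ - 1) ν v)` and `u = γ 0`:
`g(dC_{tu}(t(αu + β)), dC_{tu}(t(αu + β))) = α² t² + g(J(t - 1), J(t - 1))`, where
`J(τ) = ∂_s|_{s=0} exp_{ι γ s}(τ ν γ s)` is the transverse Jacobi field of the variation through
the normal geodesics along `γ`. Proof: `dC_{tu}(t(αu + β)) = α dC_{tu}(tu) + dC_{tu}(tβ)`; the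
Gauss identities `g(dC_v v, dC_v v) = ‖v‖²` (`val_mfderiv_coneMap_self_self`) and
`g(dC_v v, dC_v (tβ)) = 0` (`val_mfderiv_coneMap_self_of_inner_eq_zero`) kill the radial and
the mixed terms; and `dC_{tu}(tβ) = d/ds|₀ C(t γ s) = J(t - 1)` since `C(t γ s) = x(t - 1, s)`
(`coneMap_smul_of_norm_eq_one`) and the chain rule.
[cite: Weinstein1968, proof of the main theorem, steps (3)–(4)] -/
theorem val_mfderiv_coneMap_smul
    (hs : ContMDiffOn 𝓘(ℝ, V) I.tangent ∞
      (fun v ↦ (TotalSpace.mk' E (ι v) (ν v) : TangentBundle I M)) {v : V | v ≠ 0})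
    {ε : ℝ} (hε : 0 < ε)
    (hdomε : ∀ v : V, v ≠ 0 → ∀ t ∈ Ioo (-ε) ε, t ∈ maximalGeodesicDomain g.leviCivita (ι v) (ν v))
    (hhom : ∀ v : V, v ≠ 0 → ∀ t : ℝ, 0 < t →
      (TotalSpace.mk' E (ι (t • v)) (ν (t • v)) : TangentBundle I M) = TotalSpace.mk' E (ι v) (ν v))
    (hunit : ∀ v : V, v ≠ 0 → g.val (ι v) (ν v) (ν v) = 1)
    (hperp : ∀ v : V, v ≠ 0 → ∀ z : V, g.val (ι v) (mfderiv 𝓘(ℝ, V) I ι v z) (ν v) = 0)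
    {γ : ℝ → V} (hγn : ∀ s, ‖γ s‖ = 1) {β : V} (hγd : HasDerivAt γ β 0) (hβ : ⟪γ 0, β⟫ = 0)
    (α : ℝ) {t : ℝ} (ht : 0 < t) (htε : t - 1 ∈ Ioo (-ε) ε) :
    g.val (expMap g.leviCivita (ι (t • γ 0)) ((‖t • γ 0‖ - 1) • ν (t • γ 0)))
        (mfderiv 𝓘(ℝ, V) I (fun v : V ↦ expMap g.leviCivita (ι v) ((‖v‖ - 1) • ν v)) (t • γ 0)
          (t • (α • γ 0 + β)))
        (mfderiv 𝓘(ℝ, V) I (fun v : V ↦ expMap g.leviCivita (ι v) ((‖v‖ - 1) • ν v)) (t • γ 0)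
          (t • (α • γ 0 + β))) =
      α ^ 2 * t ^ 2 +
        g.val (expMap g.leviCivita (ι (γ 0)) ((t - 1) • ν (γ 0)))
          (velocity I (fun s ↦ expMap g.leviCivita (ι (γ s)) ((t - 1) • ν (γ s))) 0)
          (velocity I (fun s ↦ expMap g.leviCivita (ι (γ s)) ((t - 1) • ν (γ s))) 0) := by
  set C : V → M := fun v ↦ expMap g.leviCivita (ι v) ((‖v‖ - 1) • ν v) with hCdef
  have hγne : ∀ s, γ s ≠ 0 := fun s h ↦ by
    have := hγn s
    rw [h, norm_zero] at this
    exact zero_ne_one this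
  set v : V := t • γ 0 with hv
  have hvn : ‖v‖ = t := by
    rw [hv, norm_smul, Real.norm_eq_abs, abs_of_pos ht, hγn 0, mul_one]
  have hvpos : 0 < ‖v‖ := by rw [hvn]; exact ht
  have hv0 : v ≠ 0 := norm_pos_iff.1 hvpos
  have hvε : ‖v‖ - 1 ∈ Ioo (-ε) ε := by rw [hvn]; exact htε
  -- the annulus, an open set `∌ 0` carrying the Gauss identities
  set A : Set V := {v : V | v ≠ 0} ∩ {w : V | ‖w‖ - 1 ∈ Ioo (-ε) ε} with hA
  have hAo : IsOpen A :=
    isOpen_ne.inter (isOpen_Ioo.preimage (continuous_norm.sub continuous_const))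
  have h0A : (0 : V) ∉ A := fun h ↦ h.1 rfl
  have hvA : v ∈ A := ⟨hv0, hvε⟩
  have hsA := hs.mono (inter_subset_left : A ⊆ {v : V | v ≠ 0})
  have hdomA : ∀ w ∈ A, (‖w‖ - 1) ∈ maximalGeodesicDomain g.leviCivita (ι w) (ν w) :=
    fun w hw ↦ hdomε w hw.1 _ hw.2
  have hhomA : ∀ w ∈ A, ∀ t : ℝ, 0 < t →
      (TotalSpace.mk' E (ι (t • w)) (ν (t • w)) : TangentBundle I M) =
        TotalSpace.mk' E (ι w) (ν w) := fun w hw t ht ↦ hhom w hw.1 t ht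
  -- Gauss identities at `v`
  have G1 : g.val (C v) (mfderiv 𝓘(ℝ, V) I C v v) (mfderiv 𝓘(ℝ, V) I C v v) = t ^ 2 := by
    have h := val_mfderiv_coneMap_self_self g hAo h0A hsA hdomA hhomA hvA
    rw [hunit v hv0, mul_one] at h
    rw [← hvn]
    exact h
  have hvβ : ⟪v, t • β⟫ = 0 := by
    rw [hv, inner_smul_left, inner_smul_right, hβ]
    simp
  have G2 : g.val (C v) (mfderiv 𝓘(ℝ, V) I C v v) (mfderiv 𝓘(ℝ, V) I C v (t • β)) = 0 :=
    val_mfderiv_coneMap_self_of_inner_eq_zero g isOpen_ne (fun h ↦ h rfl) hs hε hdomε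
      (fun w hw t ht ↦ hhom w hw t ht) hunit hperp hvε
      (fun w hw ↦ by show w ≠ 0; rw [← norm_pos_iff, hw]; exact hvpos) hvβ
  have G2' : g.val (C v) (mfderiv 𝓘(ℝ, V) I C v (t • β)) (mfderiv 𝓘(ℝ, V) I C v v) = 0 := by
    rw [g.symm (C v)]
    exact G2
  -- the linear decomposition of the argument
  have hdec : t • (α • γ 0 + β) = α • v + t • β := by
    rw [hv, smul_add, smul_comm t α (γ 0)]
  have hlin : mfderiv 𝓘(ℝ, V) I C v (t • (α • γ 0 + β)) =
      α • mfderiv 𝓘(ℝ, V) I C v v + mfderiv 𝓘(ℝ, V) I C v (t • β) := by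
    have ea : mfderiv 𝓘(ℝ, V) I C v (α • v + t • β : V) =
        mfderiv 𝓘(ℝ, V) I C v (α • v : V) + mfderiv 𝓘(ℝ, V) I C v (t • β) :=
      (mfderiv 𝓘(ℝ, V) I C v).map_add (α • v) (t • β)
    have eb : mfderiv 𝓘(ℝ, V) I C v (α • v : V) = α • mfderiv 𝓘(ℝ, V) I C v v :=
      (mfderiv 𝓘(ℝ, V) I C v).map_smul α v
    have key : ∀ x : V, x = α • v + t • β → mfderiv 𝓘(ℝ, V) I C v x =
        α • mfderiv 𝓘(ℝ, V) I C v v + mfderiv 𝓘(ℝ, V) I C v (t • β) := by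
      rintro x rfl
      exact ea.trans (by rw [eb])
    exact key _ hdec
  -- expansion of the quadratic form
  set X := mfderiv 𝓘(ℝ, V) I C v v with hX
  set Y := mfderiv 𝓘(ℝ, V) I C v (t • β) with hY
  have hquad : g.val (C v) (α • X + Y) (α • X + Y) = α ^ 2 * t ^ 2 + g.val (C v) Y Y := by
    rw [ContinuousLinearMap.map_add₂, ContinuousLinearMap.map_smul₂]
    simp only [map_add, map_smul, smul_eq_mul, G1, G2, G2']
    ring
  -- `dC_v (t β) = J(t - 1)`: the cone map along `s ↦ t γ s` is the variation `x(t - 1, ·)`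
  have hCd : MDifferentiableAt 𝓘(ℝ, V) I C v :=
    ((contMDiffOn_coneMap g hAo h0A hsA hdomA v hvA).contMDiffAt (hAo.mem_nhds hvA)).mdifferentiableAt
      (by simp)
  have hvel : velocity I (C ∘ fun s : ℝ ↦ t • γ s) 0 = Y :=
    velocity_comp_of_hasDerivAt_normedSpace (F := C) (c := fun s : ℝ ↦ t • γ s) (t := 0) (w := v)
      rfl hCd (hγd.const_smul t)
  have hfun : (C ∘ fun s : ℝ ↦ t • γ s) =
      fun s ↦ expMap g.leviCivita (ι (γ s)) ((t - 1) • ν (γ s)) := by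
    funext s
    exact coneMap_smul_of_norm_eq_one g hhom (hγn s) ht
  have hJ : Y = velocity I (fun s ↦ expMap g.leviCivita (ι (γ s)) ((t - 1) • ν (γ s))) 0 := by
    rw [← hvel, hfun]
  -- the base points agree: `C v = x(t - 1, 0)`
  have hpt : C v = expMap g.leviCivita (ι (γ 0)) ((t - 1) • ν (γ 0)) :=
    coneMap_smul_of_norm_eq_one g hhom (hγn 0) ht
  have hfin : g.val (C v) Y Y =
      g.val (expMap g.leviCivita (ι (γ 0)) ((t - 1) • ν (γ 0)))
        (velocity I (fun s ↦ expMap g.leviCivita (ι (γ s)) ((t - 1) • ν (γ s))) 0)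
        (velocity I (fun s ↦ expMap g.leviCivita (ι (γ s)) ((t - 1) • ν (γ s))) 0) := by
    rw [val_congr_basePoint g hpt, hJ]
  -- assemble
  show g.val (C v) (mfderiv 𝓘(ℝ, V) I C v (t • (α • γ 0 + β)))
      (mfderiv 𝓘(ℝ, V) I C v (t • (α • γ 0 + β))) = _
  rw [hlin, hquad, hfin]

/-! ### The derivative at `t = 1` and the value at `t = 1` -/

/-- **`½ f'(1) = α² + g(D_s(ν ∘ γ)(0), (ι ∘ γ)'(0))`.** Under the hypotheses of
`val_mfderiv_coneMap_smul`, with `γ` moreover `C^∞` and `γ 0 = u`, the exit function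
`f(t) = g(dC_{tu}(t(αu + β)), dC_{tu}(t(αu + β)))` has derivative
`2 (α² + g(D_s(ν ∘ γ)(0), (ι ∘ γ)'(0)))` at `t = 1`: near `1`, `f(t) = α² t² + g(J, J)(t - 1)`
(`val_mfderiv_coneMap_smul`), and `d/dτ|_{τ=0} g(J, J) = 2 g(D_s(ν ∘ γ)(0), (ι ∘ γ)'(0))`
(`hasDerivAt_val_velocity_normalVariation_zero`).
[cite: Weinstein1968, proof of the main theorem, steps (3)–(4)]
[cite: LeeRiemannianManifolds2018, Problem 10-14 (b)] -/
theorem hasDerivAt_val_mfderiv_coneMap_smul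
    (hs : ContMDiffOn 𝓘(ℝ, V) I.tangent ∞
      (fun v ↦ (TotalSpace.mk' E (ι v) (ν v) : TangentBundle I M)) {v : V | v ≠ 0})
    {ε : ℝ} (hε : 0 < ε)
    (hdomε : ∀ v : V, v ≠ 0 → ∀ t ∈ Ioo (-ε) ε, t ∈ maximalGeodesicDomain g.leviCivita (ι v) (ν v))
    (hhom : ∀ v : V, v ≠ 0 → ∀ t : ℝ, 0 < t →
      (TotalSpace.mk' E (ι (t • v)) (ν (t • v)) : TangentBundle I M) = TotalSpace.mk' E (ι v) (ν v))
    (hunit : ∀ v : V, v ≠ 0 → g.val (ι v) (ν v) (ν v) = 1)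
    (hperp : ∀ v : V, v ≠ 0 → ∀ z : V, g.val (ι v) (mfderiv 𝓘(ℝ, V) I ι v z) (ν v) = 0)
    {γ : ℝ → V} (hγs : ContDiff ℝ ∞ γ) (hγn : ∀ s, ‖γ s‖ = 1) {u β : V} (hγ0 : γ 0 = u)
    (hγd : HasDerivAt γ β 0) (hβ : ⟪u, β⟫ = 0) (α : ℝ) :
    HasDerivAt (fun t : ℝ ↦ g.val (expMap g.leviCivita (ι (t • u)) ((‖t • u‖ - 1) • ν (t • u)))
        (mfderiv 𝓘(ℝ, V) I (fun v : V ↦ expMap g.leviCivita (ι v) ((‖v‖ - 1) • ν v)) (t • u)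
          (t • (α • u + β)))
        (mfderiv 𝓘(ℝ, V) I (fun v : V ↦ expMap g.leviCivita (ι v) ((‖v‖ - 1) • ν v)) (t • u)
          (t • (α • u + β))))
      (2 * (α ^ 2 + g.val (ι u)
        (covariantDerivAlong g.leviCivita (fun s ↦ ι (γ s)) (fun s ↦ ν (γ s)) 0)
        (velocity I (fun s ↦ ι (γ s)) 0))) 1 := by
  subst hγ0
  have hγne : ∀ s, γ s ≠ 0 := fun s h ↦ by
    have := hγn s
    rw [h, norm_zero] at this
    exact zero_ne_one this
  -- the base curve `ι ∘ γ` and the unit normal field `ν ∘ γ` along it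
  have hcV : ∀ s ∈ Ioo (-(1 : ℝ)) 1, ContMDiffAt 𝓘(ℝ, ℝ) I.tangent ∞
      (fun s ↦ (TotalSpace.mk' E (ι (γ s)) (ν (γ s)) : TangentBundle I M)) s := by
    intro s _
    have h1 : ContMDiffAt 𝓘(ℝ, V) I.tangent ∞
        (fun v ↦ (TotalSpace.mk' E (ι v) (ν v) : TangentBundle I M)) (γ s) :=
      (hs _ (hγne s)).contMDiffAt (isOpen_ne.mem_nhds (hγne s))
    exact h1.comp s hγs.contMDiff.contMDiffAt
  have hstrip : ∀ t ∈ Ioo (-ε) ε, ∀ s ∈ Ioo (-(1 : ℝ)) 1,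
      t ∈ maximalGeodesicDomain g.leviCivita (ι (γ s)) (ν (γ s)) :=
    fun t ht s _ ↦ hdomε _ (hγne s) t ht
  -- `d/dτ|₀ g(J, J) = 2 g(D_s ν, (ι ∘ γ)')`
  have hA := hasDerivAt_val_velocity_normalVariation_zero g (c := fun s ↦ ι (γ s))
    (V := fun s ↦ ν (γ s)) one_pos (by linarith : -ε < 0) hε hcV hstrip
  set F : ℝ → ℝ := fun τ ↦ g.val (expMap g.leviCivita (ι (γ 0)) (τ • ν (γ 0)))
    (velocity I (fun s ↦ expMap g.leviCivita (ι (γ s)) (τ • ν (γ s))) 0)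
    (velocity I (fun s ↦ expMap g.leviCivita (ι (γ s)) (τ • ν (γ s))) 0) with hF
  have hA' : HasDerivAt F (2 * g.val (ι (γ 0))
      (covariantDerivAlong g.leviCivita (fun s ↦ ι (γ s)) (fun s ↦ ν (γ s)) 0)
      (velocity I (fun s ↦ ι (γ s)) 0)) ((1 : ℝ) - 1) := by
    rw [sub_self]
    exact hA
  have hshift := hA'.comp_sub_const 1 1
  -- the polynomial part
  have hpow : HasDerivAt (fun t : ℝ ↦ α ^ 2 * t ^ 2) (α ^ 2 * (2 * 1)) 1 := by
    have h1 : HasDerivAt (fun t : ℝ ↦ t ^ 2) ((2 : ℕ) * (1 : ℝ) ^ (2 - 1)) 1 := hasDerivAt_pow 2 1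
    have h2 : HasDerivAt (fun t : ℝ ↦ t ^ 2) (2 * 1) 1 := by
      convert h1 using 1
      norm_num
    exact h2.const_mul (α ^ 2)
  have hsum := hpow.add hshift
  -- `f` agrees with `α² t² + F(t - 1)` near `1`
  have hev : (fun t : ℝ ↦ g.val (expMap g.leviCivita (ι (t • γ 0)) ((‖t • γ 0‖ - 1) • ν (t • γ 0)))
      (mfderiv 𝓘(ℝ, V) I (fun v : V ↦ expMap g.leviCivita (ι v) ((‖v‖ - 1) • ν v)) (t • γ 0)
        (t • (α • γ 0 + β)))
      (mfderiv 𝓘(ℝ, V) I (fun v : V ↦ expMap g.leviCivita (ι v) ((‖v‖ - 1) • ν v)) (t • γ 0)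
        (t • (α • γ 0 + β)))) =ᶠ[𝓝 1]
      fun t ↦ α ^ 2 * t ^ 2 + F (t - 1) := by
    have h1 : Ioi (0 : ℝ) ∈ 𝓝 (1 : ℝ) := Ioi_mem_nhds one_pos
    have h2 : (fun t : ℝ ↦ t - 1) ⁻¹' Ioo (-ε) ε ∈ 𝓝 (1 : ℝ) := by
      apply (isOpen_Ioo.preimage (continuous_id.sub continuous_const)).mem_nhds
      show (1 : ℝ) - 1 ∈ Ioo (-ε) ε
      rw [sub_self]
      exact ⟨by linarith, hε⟩
    filter_upwards [h1, h2] with t ht htε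
    exact val_mfderiv_coneMap_smul g hs hε hdomε hhom hunit hperp hγn hγd hβ α ht htε
  refine (hsum.congr_of_eventuallyEq hev).congr_deriv ?_
  ring

/-- **`f(1) = α² + g((ι ∘ γ)'(0), (ι ∘ γ)'(0))`**: the value of the exit function at `t = 1`
(`val_mfderiv_coneMap_smul` at `t = 1` and `J(0) = (ι ∘ γ)'(0)`,
`val_velocity_normalVariation_zero`). [cite: Weinstein1968, proof of the main theorem, step (3)] -/
theorem val_mfderiv_coneMap_one
    (hs : ContMDiffOn 𝓘(ℝ, V) I.tangent ∞
      (fun v ↦ (TotalSpace.mk' E (ι v) (ν v) : TangentBundle I M)) {v : V | v ≠ 0})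
    {ε : ℝ} (hε : 0 < ε)
    (hdomε : ∀ v : V, v ≠ 0 → ∀ t ∈ Ioo (-ε) ε, t ∈ maximalGeodesicDomain g.leviCivita (ι v) (ν v))
    (hhom : ∀ v : V, v ≠ 0 → ∀ t : ℝ, 0 < t →
      (TotalSpace.mk' E (ι (t • v)) (ν (t • v)) : TangentBundle I M) = TotalSpace.mk' E (ι v) (ν v))
    (hunit : ∀ v : V, v ≠ 0 → g.val (ι v) (ν v) (ν v) = 1)
    (hperp : ∀ v : V, v ≠ 0 → ∀ z : V, g.val (ι v) (mfderiv 𝓘(ℝ, V) I ι v z) (ν v) = 0)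
    {γ : ℝ → V} (hγn : ∀ s, ‖γ s‖ = 1) {u β : V} (hγ0 : γ 0 = u) (hγd : HasDerivAt γ β 0)
    (hβ : ⟪u, β⟫ = 0) (α : ℝ) :
    g.val (expMap g.leviCivita (ι ((1 : ℝ) • u)) ((‖(1 : ℝ) • u‖ - 1) • ν ((1 : ℝ) • u)))
        (mfderiv 𝓘(ℝ, V) I (fun v : V ↦ expMap g.leviCivita (ι v) ((‖v‖ - 1) • ν v)) ((1 : ℝ) • u)
          ((1 : ℝ) • (α • u + β)))
        (mfderiv 𝓘(ℝ, V) I (fun v : V ↦ expMap g.leviCivita (ι v) ((‖v‖ - 1) • ν v)) ((1 : ℝ) • u)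
          ((1 : ℝ) • (α • u + β))) =
      α ^ 2 + g.val (ι u) (velocity I (fun s ↦ ι (γ s)) 0) (velocity I (fun s ↦ ι (γ s)) 0) := by
  subst hγ0
  have h1ε : (1 : ℝ) - 1 ∈ Ioo (-ε) ε := by
    rw [sub_self]
    exact ⟨by linarith, hε⟩
  rw [val_mfderiv_coneMap_smul g hs hε hdomε hhom hunit hperp hγn hγd hβ α one_pos h1ε, sub_self,
    val_velocity_normalVariation_zero g (fun s ↦ ι (γ s)) (fun s ↦ ν (γ s))]
  ring

/-! ### The exit inequality from a lower bound on the second fundamental form -/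

omit [Fact (1 ≤ n)] [FiniteDimensional ℝ E] [CompleteSpace E] [T2Space M] [BoundarylessManifold I M]
  [g.HasLeviCivita] [CovariantDerivative.ContMDiffCovariantDerivative g.leviCivita 1]
  [CovariantDerivative.ContMDiffCovariantDerivative g.leviCivita ((⊤ : ℕ∞) : ℕ∞ω)]
  [IsManifold I ∞ M] [NormedSpace ℝ E] [ChartedSpace H M] in
/-- Through every unit vector `u` and every `β ⊥ u` passes a smooth curve of the unit sphere with
velocity `β` at `u`: the great circle `cos(‖β‖ s) u + sin(‖β‖ s) β/‖β‖` (`β ≠ 0`), the constant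
curve (`β = 0`). [folklore] -/
theorem exists_curve_sphere_hasDerivAt {u β : V} (hu : ‖u‖ = 1) (hβ : ⟪u, β⟫ = 0) :
    ∃ γ : ℝ → V, ContDiff ℝ ∞ γ ∧ (∀ s, ‖γ s‖ = 1) ∧ γ 0 = u ∧ HasDerivAt γ β 0 := by
  have hu0 : u ≠ 0 := by
    rw [← norm_ne_zero_iff, hu]
    exact one_ne_zero
  by_cases hβ0 : β = 0
  · subst hβ0
    exact ⟨fun _ ↦ u, contDiff_const, fun _ ↦ hu, rfl, hasDerivAt_const 0 u⟩
  · refine ⟨fun s ↦ Real.cos (‖β‖ / ‖u‖ * s) • u + Real.sin (‖β‖ / ‖u‖ * s) • ((‖u‖ / ‖β‖) • β),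
      ?_, fun s ↦ (norm_greatCircle hu0 hβ0 hβ s).trans hu, greatCircle_zero u β,
      hasDerivAt_greatCircle_zero hu0 hβ0⟩
    have h1 : ContDiff ℝ ∞ fun s : ℝ ↦ ‖β‖ / ‖u‖ * s := contDiff_const.mul contDiff_id
    exact ((Real.contDiff_cos.comp h1).smul contDiff_const).add
      ((Real.contDiff_sin.comp h1).smul contDiff_const)

/-- **The exit inequality of the cone map from `II_ν ≥ -λ`.** Let `v ↦ (ι v, ν v) ∈ TM` be `C^∞`
and positively `0`-homogeneous on `V ∖ {0}`, `|ν|_g = 1`, `ν ⊥ range dι`, the normal geodesics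
defined for all times in `(-ε, ε)`, and suppose that along every smooth curve `γ` of the unit
sphere of `V` the covariant derivative of the unit normal field satisfies
`g(D_s(ν ∘ γ)(0), (ι ∘ γ)'(0)) ≥ -λ g((ι ∘ γ)'(0), (ι ∘ γ)'(0))` (`λ ≥ 0`; the second fundamental
form of the hypersurface w.r.t. `ν` is `≥ -λ`). Then the cone map
`C(v) = exp_{ι v}((‖v‖ - 1) ν v)` satisfies the exit inequality of
`two_le_minimalGeodesicMultiplicity_of_radial` at radius `R = 1`: for every unit `u` and every
`w`, `-λ f(1) ≤ ½ f'(1)` for `f(t) = g(dC_{tu}(tw), dC_{tu}(tw))`. Indeed, with `w = αu + β`,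
`β ⊥ u`, and a sphere curve `γ` through `u` with velocity `β`
(`exists_curve_sphere_hasDerivAt`): `f(1) = α² + g(X, X)` and
`½ f'(1) = α² + g(D_s(ν ∘ γ)(0), X)`, `X = (ι ∘ γ)'(0)` (`val_mfderiv_coneMap_one`,
`hasDerivAt_val_mfderiv_coneMap_smul`), and `-λ α² ≤ α²`.
[cite: Weinstein1968, proof of the main theorem, step (4)] -/
theorem neg_mul_val_le_half_deriv_coneMap
    (hs : ContMDiffOn 𝓘(ℝ, V) I.tangent ∞
      (fun v ↦ (TotalSpace.mk' E (ι v) (ν v) : TangentBundle I M)) {v : V | v ≠ 0})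
    {ε : ℝ} (hε : 0 < ε)
    (hdomε : ∀ v : V, v ≠ 0 → ∀ t ∈ Ioo (-ε) ε, t ∈ maximalGeodesicDomain g.leviCivita (ι v) (ν v))
    (hhom : ∀ v : V, v ≠ 0 → ∀ t : ℝ, 0 < t →
      (TotalSpace.mk' E (ι (t • v)) (ν (t • v)) : TangentBundle I M) = TotalSpace.mk' E (ι v) (ν v))
    (hunit : ∀ v : V, v ≠ 0 → g.val (ι v) (ν v) (ν v) = 1)
    (hperp : ∀ v : V, v ≠ 0 → ∀ z : V, g.val (ι v) (mfderiv 𝓘(ℝ, V) I ι v z) (ν v) = 0)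
    {lam : ℝ} (hlam : 0 ≤ lam)
    (hII : ∀ γ : ℝ → V, ContDiff ℝ ∞ γ → (∀ s, ‖γ s‖ = 1) →
      -(lam * g.val (ι (γ 0)) (velocity I (fun s ↦ ι (γ s)) 0) (velocity I (fun s ↦ ι (γ s)) 0)) ≤
        g.val (ι (γ 0)) (covariantDerivAlong g.leviCivita (fun s ↦ ι (γ s)) (fun s ↦ ν (γ s)) 0)
          (velocity I (fun s ↦ ι (γ s)) 0))
    (u w : V) (hu : ‖u‖ = 1) :
    -(lam * g.val (expMap g.leviCivita (ι ((1 : ℝ) • u)) ((‖(1 : ℝ) • u‖ - 1) • ν ((1 : ℝ) • u)))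
        (mfderiv 𝓘(ℝ, V) I (fun v : V ↦ expMap g.leviCivita (ι v) ((‖v‖ - 1) • ν v)) ((1 : ℝ) • u)
          ((1 : ℝ) • w))
        (mfderiv 𝓘(ℝ, V) I (fun v : V ↦ expMap g.leviCivita (ι v) ((‖v‖ - 1) • ν v)) ((1 : ℝ) • u)
          ((1 : ℝ) • w))) ≤
      (1 / 2) * deriv (fun t : ℝ ↦
        g.val (expMap g.leviCivita (ι (t • u)) ((‖t • u‖ - 1) • ν (t • u)))
          (mfderiv 𝓘(ℝ, V) I (fun v : V ↦ expMap g.leviCivita (ι v) ((‖v‖ - 1) • ν v)) (t • u)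
            (t • w))
          (mfderiv 𝓘(ℝ, V) I (fun v : V ↦ expMap g.leviCivita (ι v) ((‖v‖ - 1) • ν v)) (t • u)
            (t • w))) 1 := by
  -- decompose `w = α u + β` with `β ⊥ u`
  set α : ℝ := ⟪u, w⟫ with hα
  set β : V := w - α • u with hβdef
  have huu : ⟪u, u⟫ = 1 := by
    rw [real_inner_self_eq_norm_sq, hu, one_pow]
  have hβ : ⟪u, β⟫ = 0 := by
    rw [hβdef, inner_sub_right, inner_smul_right, huu, hα, mul_one, sub_self]
  have hwdec : w = α • u + β := by rw [hβdef]; abel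
  obtain ⟨γ, hγs, hγn, hγ0, hγd⟩ := exists_curve_sphere_hasDerivAt hu hβ
  have key : ∀ w' : V, w' = α • u + β →
      -(lam * g.val (expMap g.leviCivita (ι ((1 : ℝ) • u)) ((‖(1 : ℝ) • u‖ - 1) • ν ((1 : ℝ) • u)))
          (mfderiv 𝓘(ℝ, V) I (fun v : V ↦ expMap g.leviCivita (ι v) ((‖v‖ - 1) • ν v)) ((1 : ℝ) • u)
            ((1 : ℝ) • w'))
          (mfderiv 𝓘(ℝ, V) I (fun v : V ↦ expMap g.leviCivita (ι v) ((‖v‖ - 1) • ν v)) ((1 : ℝ) • u)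
            ((1 : ℝ) • w'))) ≤
        (1 / 2) * deriv (fun t : ℝ ↦
          g.val (expMap g.leviCivita (ι (t • u)) ((‖t • u‖ - 1) • ν (t • u)))
            (mfderiv 𝓘(ℝ, V) I (fun v : V ↦ expMap g.leviCivita (ι v) ((‖v‖ - 1) • ν v)) (t • u)
              (t • w'))
            (mfderiv 𝓘(ℝ, V) I (fun v : V ↦ expMap g.leviCivita (ι v) ((‖v‖ - 1) • ν v)) (t • u)
              (t • w'))) 1 := by
    rintro w' rfl
    rw [(hasDerivAt_val_mfderiv_coneMap_smul g hs hε hdomε hhom hunit hperp hγs hγn hγ0 hγd hβ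
        α).deriv,
      val_mfderiv_coneMap_one g hs hε hdomε hhom hunit hperp hγn hγ0 hγd hβ α]
    -- the second fundamental form bound along `γ`, read at the base point `ι u`
    have h1 := hII γ hγs hγn
    rw [hγ0] at h1
    nlinarith [sq_nonneg α, mul_nonneg hlam (sq_nonneg α), h1]
  exact key w hwdec

end Literature.Geometry.Riemannian
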